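import Mathlib
import Literature.Probability.Percolation.PercolationProofs
import Literature.Probability.Percolation.PercolationEvents
import Literature.Probability.Percolation.Crossings
import Literature.Probability.Percolation.SharpnessDCTProofs
import Literature.Probability.LatticeModels.ProdBernoulliIndependence
import Literature.Probability.Percolation.ConditionalPositiveAssociation
import Literature.Probability.Percolation.ConditionalPositiveAssociationProofs
import Literature.Probability.Percolation.TwoClusterConditionalAssociation
import Literature.Probability.Percolation.ClusterBoundary
import Literature.Probability.Percolation.PlanarDuality
import Literature.Barriers.CriticalPhenomena.TimarGoodBox
import Summits.CriticalPhenomena.PercolationContinuityZ3.Theorems.PercNearOneGluingAdditiveGluingGoodStepBridge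
import Summits.CriticalPhenomena.PercolationContinuityZ3.Theorems.PercNearOneGluingAdditiveGluingGoodStepC1DownPaths
import HarnessLib

/-! # Crux `PercNearOneGluing.AdditiveGluing` (stmt-CriticalPhenomena-4576), line `subuniform-dead-pocket-maximum`,
# stub `stub_goodStep` — the |A∖b| = 2 kernel C1 for DOWN-closed pocket families, II: disintegration along `C(a₂)` (siege k3)

Helper file (siege k3, `--supports stmt-CriticalPhenomena-4576`); continues `…GoodStepC1DownPaths.lean`.

## Content (measure-theoretic; `μ = prodBernoulli w` on `BondConfig (Fin n)`)

* Spatial Markov property on `{C(a₂) = U}`: an event determined by the pairs inside `Uᶜ` is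
  independent of `{C(a₂) = U}` (`c1Down_real_clusterIs_inter_of_determinedBy`; from
  `determinedBy_clusterIs` and `prodBernoulli_real_inter_of_determinedBy`).
* The four TERM IDENTITIES on `{C(a₂) = U} ∩ {a₂ ↮ a₁}` for the comparison of
  `μ({aᵢ ↔ b} ∩ F_R ∩ {a₂ ↮ a₁})`, `i = 1, 2`, with the sandwiched observer event `F_R`
  (`c1Down_term_t`, `_f`, `_fρ`, `_tρ`): in terms of `φ_t(U) = [b ∉ U]·μ(a₁ ↔ b in Uᶜ)`,
  `φ_f(U) = [b ∈ U]`, `ρ(U) = 1` if `o ∈ U` and `ρ(U) = μ(the cluster of o inside Uᶜ is a pocket of R)`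
  otherwise; the `a₁`-side is an INEQUALITY, by Harris inside `Uᶜ` (increasing `{a₁ ↔ b in Uᶜ}`
  against the decreasing pocket event of a down-closed family, `prodBernoulli_harris_upper_lower`).
* Disintegration along the cluster: `∫_D φ(C(a₂)) dμ = Σ_U φ(U)·μ({C(a₂)=U} ∩ D)`
  (`c1Down_setIntegral_cluster`), and the vertex finset of the open edge cluster (`c1Down_filter_vert_eq`).
All folklore (Grimmett 1999 §2.2); no new definitions.
-/

namespace Summit.CriticalPhenomena.PercolationContinuityZ3.Theorems

open MeasureTheory Set
open Literature.Probability.LatticeModels (prodBernoulli)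
open Literature.Probability.Percolation (BondConfig openConn openConnIn openGraph openCluster
  openGraph_adj openEdgeCluster DeterminedBy determinedBy_iff PathIn clusterIs mem_clusterIs
  edgesTouching determinedBy_clusterIs disjoint_edgesTouching_compl_sym2 openConnIn_subset_openConn)

noncomputable section
open Classical

section Measure

variable {n : ℕ}

/-! ### Measure identities on `{C(a₂) = U}` -/

/-- **Spatial Markov property on `{C(a₂) = U}`**: an event determined by the pairs inside `Uᶜ` is
independent of `{C(a₂) = U}`. [folklore; Grimmett 1999 §2.2] -/
theorem c1Down_real_clusterIs_inter_of_determinedBy (w : Sym2 (Fin n) → unitInterval) (a₂ : Fin n)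
    (U : Finset (Fin n)) {B : Set (BondConfig (Fin n))}
    (hB : DeterminedBy B (((↑U : Set (Fin n))ᶜ).sym2)) :
    (prodBernoulli w).real (clusterIs a₂ U ∩ B) =
      (prodBernoulli w).real (clusterIs a₂ U) * (prodBernoulli w).real B := by
  set F : Finset (Sym2 (Fin n)) := (Set.toFinite (edgesTouching (↑U : Set (Fin n)))).toFinset
    with hF
  have hFc : (↑F : Set (Sym2 (Fin n))) = edgesTouching (↑U : Set (Fin n)) := by
    rw [hF, Set.Finite.coe_toFinset]
  refine Literature.Probability.LatticeModels.prodBernoulli_real_inter_of_determinedBy w F ?_ ?_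
    (Set.toFinite _).measurableSet (Set.toFinite _).measurableSet
  · rw [hFc]; exact determinedBy_clusterIs a₂ U
  · rw [hFc]
    exact hB.mono (disjoint_edgesTouching_compl_sym2 _).subset_compl_left

/-- The `a₁`-term on `{C(a₂) = U} ∩ {a₂ ↮ a₁}`:
`μ(C(a₂)=U, a₂↮a₁, a₁↔b) = [b ∉ U]·μ(a₁ ↔ b in Uᶜ) · μ(C(a₂)=U, a₂↮a₁)`. [folklore] -/
theorem c1Down_term_t (w : Sym2 (Fin n) → unitInterval) (a₂ a₁ b : Fin n) (U : Finset (Fin n)) :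
    (prodBernoulli w).real (clusterIs a₂ U ∩ ((openConn a₂ a₁)ᶜ ∩ openConn a₁ b)) =
      (if b ∈ U then 0 else (prodBernoulli w).real (openConnIn ((↑U : Set (Fin n))ᶜ) a₁ b)) *
        (prodBernoulli w).real (clusterIs a₂ U ∩ (openConn a₂ a₁)ᶜ) := by
  rw [← Set.inter_assoc, c1Down_clusterIs_inter_D]
  by_cases ha : a₁ ∈ U
  · simp only [ha, if_true, Set.empty_inter, measureReal_empty, mul_zero]
  · simp only [ha, if_false]
    by_cases hb : b ∈ U
    · rw [if_pos hb, c1Down_clusterIs_inter_openConn_eq_empty a₂ a₁ b U hb ha, measureReal_empty,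
        zero_mul]
    · rw [if_neg hb, goodBridge_real_clusterIs_inter_openConn w U a₂ a₁ b ha, mul_comm]

/-- The `a₂`-term on `{C(a₂) = U} ∩ {a₂ ↮ a₁}`: `μ(C(a₂)=U, a₂↮a₁, a₂↔b) = [b ∈ U]·μ(C(a₂)=U, a₂↮a₁)`.
[folklore] -/
theorem c1Down_term_f (w : Sym2 (Fin n) → unitInterval) (a₂ a₁ b : Fin n) (U : Finset (Fin n)) :
    (prodBernoulli w).real (clusterIs a₂ U ∩ ((openConn a₂ a₁)ᶜ ∩ openConn a₂ b)) =
      (if b ∈ U then 1 else 0) * (prodBernoulli w).real (clusterIs a₂ U ∩ (openConn a₂ a₁)ᶜ) := by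
  rw [← Set.inter_assoc, c1Down_clusterIs_inter_D]
  by_cases ha : a₁ ∈ U
  · simp only [ha, if_true, Set.empty_inter, measureReal_empty, mul_zero]
  · simp only [ha, if_false]
    rw [c1Down_clusterIs_inter_openConn_self]
    by_cases hb : b ∈ U
    · simp only [hb, if_true, one_mul]
    · simp only [hb, if_false, measureReal_empty, zero_mul]

/-- The `a₂`-term with the sandwiched event:
`μ(C(a₂)=U, a₂↮a₁, a₂↔b, F) = [b ∈ U]·ρ(U)·μ(C(a₂)=U, a₂↮a₁)` with `ρ(U) = 1` if `o ∈ U` and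
`ρ(U) = μ(the cluster of o inside Uᶜ is a pocket of R)` otherwise. [folklore] -/
theorem c1Down_term_fρ (w : Sym2 (Fin n) → unitInterval) (a₂ a₁ b o : Fin n) (U : Finset (Fin n))
    (R : Finset (Finset (Fin n))) (hR : ∀ W ∈ R, a₁ ∉ W) :
    (prodBernoulli w).real (clusterIs a₂ U ∩ ((openConn a₂ a₁)ᶜ ∩ (openConn a₂ b ∩
      {ω : BondConfig (Fin n) | a₁ ∉ openCluster ω o ∧
        (a₂ ∈ openCluster ω o ∨ ∃ W ∈ R, openCluster ω o = ↑W)}))) =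
      (if b ∈ U then 1 else 0) *
        ((if o ∈ U then 1 else (prodBernoulli w).real {ω : BondConfig (Fin n) | ∃ W ∈ R, ∀ y : Fin n,
            ω ∈ openConnIn ((↑U : Set (Fin n))ᶜ) o y ↔ y ∈ W}) *
          (prodBernoulli w).real (clusterIs a₂ U ∩ (openConn a₂ a₁)ᶜ)) := by
  rw [← Set.inter_assoc, c1Down_clusterIs_inter_D]
  by_cases ha : a₁ ∈ U
  · simp only [ha, if_true, Set.empty_inter, measureReal_empty, mul_zero]
  · simp only [ha, if_false]
    rw [← Set.inter_assoc, c1Down_clusterIs_inter_openConn_self]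
    by_cases hb : b ∈ U
    · simp only [hb, if_true, one_mul]
      by_cases ho : o ∈ U
      · rw [if_pos ho, one_mul, Set.inter_eq_left.2 (c1Down_clusterIs_subset_F a₂ a₁ o U R ho ha)]
      · rw [if_neg ho, c1Down_clusterIs_inter_F a₂ a₁ o U R hR ho,
          c1Down_real_clusterIs_inter_of_determinedBy w a₂ U (c1Down_determinedBy_rev o U R), mul_comm]
    · simp only [hb, if_false, Set.empty_inter, measureReal_empty, zero_mul]

/-- The `a₁`-term with the sandwiched event, for a DOWN-closed family (Harris inside `Uᶜ`):
`μ(C(a₂)=U, a₂↮a₁, a₁↔b, F) ≤ [b ∉ U]·μ(a₁ ↔ b in Uᶜ)·ρ(U)·μ(C(a₂)=U, a₂↮a₁)`. [folklore] -/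
theorem c1Down_term_tρ (w : Sym2 (Fin n) → unitInterval) (a₂ a₁ b o : Fin n) (U : Finset (Fin n))
    (R : Finset (Finset (Fin n))) (hR : ∀ W ∈ R, a₁ ∉ W)
    (hdown : ∀ W ∈ R, ∀ W' : Finset (Fin n), o ∈ W' → W' ⊆ W → W' ∈ R) :
    (prodBernoulli w).real (clusterIs a₂ U ∩ ((openConn a₂ a₁)ᶜ ∩ (openConn a₁ b ∩
      {ω : BondConfig (Fin n) | a₁ ∉ openCluster ω o ∧
        (a₂ ∈ openCluster ω o ∨ ∃ W ∈ R, openCluster ω o = ↑W)}))) ≤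
      (if b ∈ U then 0 else (prodBernoulli w).real (openConnIn ((↑U : Set (Fin n))ᶜ) a₁ b)) *
        ((if o ∈ U then 1 else (prodBernoulli w).real {ω : BondConfig (Fin n) | ∃ W ∈ R, ∀ y : Fin n,
            ω ∈ openConnIn ((↑U : Set (Fin n))ᶜ) o y ↔ y ∈ W}) *
          (prodBernoulli w).real (clusterIs a₂ U ∩ (openConn a₂ a₁)ᶜ)) := by
  rw [← Set.inter_assoc, c1Down_clusterIs_inter_D]
  by_cases ha : a₁ ∈ U
  · simp only [ha, if_true, Set.empty_inter, measureReal_empty, mul_zero, le_refl]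
  · simp only [ha, if_false]
    by_cases hb : b ∈ U
    · rw [if_pos hb, zero_mul, ← Set.inter_assoc, c1Down_clusterIs_inter_openConn_eq_empty a₂ a₁ b U hb ha,
        Set.empty_inter, measureReal_empty]
    · rw [if_neg hb]
      by_cases ho : o ∈ U
      · rw [if_pos ho, one_mul]
        calc (prodBernoulli w).real (clusterIs a₂ U ∩ (openConn a₁ b ∩
              {ω : BondConfig (Fin n) | a₁ ∉ openCluster ω o ∧
                (a₂ ∈ openCluster ω o ∨ ∃ W ∈ R, openCluster ω o = ↑W)}))
            ≤ (prodBernoulli w).real (clusterIs a₂ U ∩ openConn a₁ b) :=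
              measureReal_mono (Set.inter_subset_inter_right _ Set.inter_subset_left)
          _ = (prodBernoulli w).real (openConnIn ((↑U : Set (Fin n))ᶜ) a₁ b) *
                (prodBernoulli w).real (clusterIs a₂ U) := by
              rw [goodBridge_real_clusterIs_inter_openConn w U a₂ a₁ b ha, mul_comm]
      · rw [if_neg ho]
        have hset : clusterIs a₂ U ∩ (openConn a₁ b ∩
            {ω : BondConfig (Fin n) | a₁ ∉ openCluster ω o ∧
              (a₂ ∈ openCluster ω o ∨ ∃ W ∈ R, openCluster ω o = ↑W)}) =
            clusterIs a₂ U ∩ (openConnIn ((↑U : Set (Fin n))ᶜ) a₁ b ∩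
              {ω : BondConfig (Fin n) | ∃ W ∈ R, ∀ y : Fin n,
                ω ∈ openConnIn ((↑U : Set (Fin n))ᶜ) o y ↔ y ∈ W}) := by
          have h1 := goodBridge_clusterIs_inter_openConn U a₂ a₁ b ha
          have h2 := c1Down_clusterIs_inter_F a₂ a₁ o U R hR ho
          ext ω
          constructor
          · rintro ⟨hU, hab, hF⟩
            exact ⟨hU, ((Set.ext_iff.1 h1 ω).1 ⟨hU, hab⟩).2, ((Set.ext_iff.1 h2 ω).1 ⟨hU, hF⟩).2⟩
          · rintro ⟨hU, hab, hF⟩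
            exact ⟨hU, ((Set.ext_iff.1 h1 ω).2 ⟨hU, hab⟩).2, ((Set.ext_iff.1 h2 ω).2 ⟨hU, hF⟩).2⟩
        rw [hset, c1Down_real_clusterIs_inter_of_determinedBy w a₂ U
          ((Literature.Probability.Percolation.DCT16.determinedBy_openConnIn _ a₁ b le_rfl).inter
            (c1Down_determinedBy_rev o U R))]
        have hH := Literature.Probability.LatticeModels.prodBernoulli_harris_upper_lower w
          (Literature.Probability.Percolation.isUpperSet_openConnIn ((↑U : Set (Fin n))ᶜ) a₁ b)
          (c1Down_isLowerSet_rev o U R hdown ho) MeasurableSet.of_discrete MeasurableSet.of_discrete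
        calc (prodBernoulli w).real (clusterIs a₂ U) * (prodBernoulli w).real
              (openConnIn ((↑U : Set (Fin n))ᶜ) a₁ b ∩ {ω : BondConfig (Fin n) | ∃ W ∈ R, ∀ y : Fin n,
                ω ∈ openConnIn ((↑U : Set (Fin n))ᶜ) o y ↔ y ∈ W})
            ≤ (prodBernoulli w).real (clusterIs a₂ U) *
                ((prodBernoulli w).real (openConnIn ((↑U : Set (Fin n))ᶜ) a₁ b) *
                  (prodBernoulli w).real {ω : BondConfig (Fin n) | ∃ W ∈ R, ∀ y : Fin n,
                    ω ∈ openConnIn ((↑U : Set (Fin n))ᶜ) o y ↔ y ∈ W}) :=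
              mul_le_mul_of_nonneg_left hH measureReal_nonneg
          _ = _ := by ring

end Measure

section Integral

variable {n : ℕ}

/-! ### From integrals of functions of the cluster to sums over its values -/

/-- The finset of vertices of the open cluster of `a₂` determines the event `{C(a₂) = U}`. [folklore] -/
theorem c1Down_mem_clusterIs_iff_filter (a₂ : Fin n) (U : Finset (Fin n)) (ω : BondConfig (Fin n)) :
    ω ∈ clusterIs a₂ U ↔ (Finset.univ.filter fun v => v ∈ openCluster ω a₂) = U := by
  rw [mem_clusterIs]
  constructor
  · intro h
    ext v
    simp only [Finset.mem_filter, Finset.mem_univ, true_and, h, Finset.mem_coe]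
  · intro h
    ext v
    have := congrArg (v ∈ ·) h
    simp only [Finset.mem_filter, Finset.mem_univ, true_and, eq_iff_iff] at this
    rw [Finset.mem_coe]
    exact this

/-- **Disintegration along the cluster of `a₂`**: the integral over `D` of a function of the
(finset of vertices of the) open cluster of `a₂` is the sum of its values weighted by
`μ({C(a₂) = U} ∩ D)`. [folklore] -/
theorem c1Down_setIntegral_cluster (w : Sym2 (Fin n) → unitInterval) (a₂ : Fin n)
    (D : Set (BondConfig (Fin n))) (φ : Finset (Fin n) → ℝ) :
    ∫ ω in D, φ (Finset.univ.filter fun v => v ∈ openCluster ω a₂) ∂(prodBernoulli w) =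
      ∑ U : Finset (Fin n), φ U * (prodBernoulli w).real (clusterIs a₂ U ∩ D) := by
  have hpt : ∀ ω : BondConfig (Fin n), φ (Finset.univ.filter fun v => v ∈ openCluster ω a₂) =
      ∑ U : Finset (Fin n), (clusterIs a₂ U).indicator (fun _ => φ U) ω := by
    intro ω
    rw [Finset.sum_eq_single (Finset.univ.filter fun v => v ∈ openCluster ω a₂)]
    · rw [Set.indicator_of_mem ((c1Down_mem_clusterIs_iff_filter a₂ _ ω).2 rfl)]
    · intro U _ hU
      rw [Set.indicator_of_notMem]
      intro hω
      exact hU ((c1Down_mem_clusterIs_iff_filter a₂ U ω).1 hω).symm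
    · intro h; exact absurd (Finset.mem_univ _) h
  simp_rw [hpt]
  rw [integral_finsetSum]
  · refine Finset.sum_congr rfl fun U _ => ?_
    rw [setIntegral_indicator (MeasurableSet.of_discrete), setIntegral_const, smul_eq_mul,
      Set.inter_comm, mul_comm]
  · intro U _
    exact (integrable_const (φ U)).indicator MeasurableSet.of_discrete

/-- The vertices of the open edge cluster of `a₂`, as a finset, are the open cluster of `a₂`. [folklore] -/
theorem c1Down_filter_vert_eq (a₂ : Fin n) (ω : BondConfig (Fin n)) :
    (Finset.univ.filter fun v : Fin n => v = a₂ ∨ ∃ e ∈ openEdgeCluster ω a₂, v ∈ e) =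
      Finset.univ.filter fun v => v ∈ openCluster ω a₂ := by
  have h := c1Down_vert_openEdgeCluster ω a₂
  ext v
  have hv := congrArg (v ∈ ·) h
  simp only [Set.mem_setOf_eq, eq_iff_iff] at hv
  simp only [Finset.mem_filter, Finset.mem_univ, true_and, hv]


/-- **Registered helper stub `stub_goodStepC1DownMarkov_k3`** (siege k3, toolkit II): the spatial
Markov property on `{C(a₂) = U}` — an event determined by the pairs inside `Uᶜ` is independent of
`{C(a₂) = U}`. [folklore; Grimmett 1999 §2.2] -/
theorem stub_goodStepC1DownMarkov_k3 :
    ∀ (n : ℕ) (w : Sym2 (Fin n) → unitInterval) (a₂ : Fin n) (U : Finset (Fin n))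
      (B : Set (BondConfig (Fin n))), DeterminedBy B (((U : Set (Fin n))ᶜ).sym2) →
      (prodBernoulli w).real ({ω : BondConfig (Fin n) | openCluster ω a₂ = (U : Set (Fin n))} ∩ B) =
        (prodBernoulli w).real {ω : BondConfig (Fin n) | openCluster ω a₂ = (U : Set (Fin n))} *
          (prodBernoulli w).real B :=
  fun _ w a₂ U _ hB => c1Down_real_clusterIs_inter_of_determinedBy w a₂ U hB

end Integral

end

end Summit.CriticalPhenomena.PercolationContinuityZ3.Theorems
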